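import Summits.BirchSwinnertonDyer.Rank1Residual.X11b.Three.ClassRecordAtThree
import Summits.BirchSwinnertonDyer.Rank1Residual.X11b.Three.CornerDischarge
import Summits.BirchSwinnertonDyer.Rank1Residual.X11b.Three.CornerResidual
import HarnessLib

/-!
# Class X11b at `p = 3` (team N8/O2 = cell `b2b-bsdres`, seat x11b3-p3, lead deal #4 (R6)):
# CLASS RECORD v4 — corollaries of `Three.forall_bsdp_of_classRecord` (residual currency; later:
# the HALVES and corner-split substitutions)

HONEST FRAMING (verbatim, cell `b2b-bsdres`, run/shared/lean/b2b/bsd-rank1-residual/): the goal of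
the cell is to DELETE the COMBINATION-SHAPED residual classes for ALL analytic-rank `≤ 1` curves
over `ℚ` — "full BSD formula for every rank `≤ 1` curve in class `C`" assembled STRICTLY from
published theorems — so that the rank-`≤ 1` remainder becomes exactly the CONSTRUCTION-SHAPED
classes, which are TYPED (missing-input Props), NOT attempted; this is not "finishing BSD".
Team N8/O2 (X11b at `3`; RESIDUAL-MAP §I O2 OPEN). Research route; nothing booked; NO label
changes. THEOREMS ONLY (no definition, no named fact, no `sorry`).

## What this file does

`ClassRecordAtThree.lean` (p252266) holds CLASS RECORD v4 as ONE theorem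
`Three.forall_bsdp_of_classRecord : [19 published facts] → [typed binders by road] →
∀ W, ClassX11b W 3 → BSDp W 3`. This companion file (kept separate so that the record file stays
under the size lint and byte-stable) collects its COROLLARIES:

* §1 `forall_missingInputAt_of_classRecord` — the same record in the currency of the cell's typed
  residual `X11Three.MissingInputAt W` (REFEREE R6.2; the form RESIDUAL-MAP §I O2 rows quote):
  under exactly the binders of the record, the class's typed missing input holds at every X11b@3
  pair (`X11Three.missingInputAt_of_bsdp`: `BSDp ⇒ MissingPPartAt ⇒ PPart`, `Ш` finite by GZK,
  `L'(E,1) ≠ 0` by modularity).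
* (to be appended when they land) the substitution of road (b)'s `StepLAt W` binder by x11b3-p9's
  HALVES H1–H3 (`Three.stepLAt_of_halves`, S10) and of the corner-split binder `hCs` by x11b3-p8's
  typed residual `Three.CornerSplitResidualAt` (R2).

CONDITIONAL; nothing booked; O2 OPEN; X11 ∧ `r = 1` ∧ `p = 3` stays CONSTRUCTION-SHAPED (R6.2).

References: [Miller2011LMS] §1, Def. 1.1; [Skinner2016PacificMC] Thm. A, Thm. C;
[SteinWuthrich2013] Thm. 6.1, §4.2; [Disegni2020] Thm. 1; [Castella2018] Thm. 2.3, Thm. 3.2;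
[BarriosEtAl2025] Thm. 5.1; [JetchevSkinnerWan2017] §7.4; [Wuthrich2014] Prop. 21.
-/

noncomputable section

open scoped Classical

open WeierstrassCurve NumberField IsDedekindDomain Field Literature.NumberTheory.EllipticCurves
  Rat.HeightOneSpectrum
  Literature.NumberTheory.DiophantineGeometry
  Literature.NumberTheory.EllipticCurves.GreenbergSelmer
  Literature.NumberTheory.EllipticCurves.ModularForms
  Literature.NumberTheory.EllipticCurves.Rank1Residual
  Literature.NumberTheory.EllipticCurves.Rank1Residual.Typed
  Literature.NumberTheory.EllipticCurves.Wuthrich2014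
  Literature.NumberTheory.EllipticCurves.BalakrishnanEtAl2019
  Literature.NumberTheory.EllipticCurves.Skinner2016
  Literature.NumberTheory.EllipticCurves.SteinWuthrich2013
  Literature.NumberTheory.EllipticCurves.Disegni2020
  Literature.NumberTheory.EllipticCurves.BarriosEtAl2025
  Literature.NumberTheory.QuadraticFields.Quadratic
  Literature.NumberTheory.Automorphic
  Literature.NumberTheory.GaloisRepresentations Literature.NumberTheory.GaloisCohomology
  Summit.BirchSwinnertonDyer.Rank1Residual.X11b.AcSelmer
  Summit.BirchSwinnertonDyer.Rank1Residual.X11b.LocBridge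

namespace Summit.BirchSwinnertonDyer.Rank1Residual.X11b.Three

/-! ### §1. The record in the currency of the cell's typed residual `X11Three.MissingInputAt` (R6.2) -/

/-- **CLASS RECORD v4 ⟹ the CLASS's typed missing input at every X11b@3 pair.** Under exactly the
binders of `forall_bsdp_of_classRecord` (19 published facts + road (a)'s per-pair
`RegulatorNonvanishingAt W 3` on nonsplit ∧ (ram) + road (b)'s `StepLAt W` / displays / (T2α)@3 /
(T2γ)@3∖α binders on split ∧ (ram) + road (d)'s `StepLAt W` + upper half off (ram) + the two corner
binders), the typed residual of RESIDUAL-MAP §I O2 / REFEREE R6.2, `X11Three.MissingInputAt W`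
("A′-locus ⇒ `PPart W 3`"), holds at every pair of the class (`X11Three.missingInputAt_of_bsdp`).
This is the form the residual map's rows quote: WHAT IS LEFT of X11b@3 = the typed binders, by
named sub-population. CONDITIONAL; nothing booked; O2 OPEN; no label change.
[cite: Miller2011LMS, §1 and Def. 1.1] [cite: Skinner2016PacificMC, Thm. A and Thm. C (§1)]
[cite: Disegni2020, Thm. 1 (§1.2)] [cite: Castella2018, Thm. 2.3 (p. 5), Thm. 3.2 (p. 9)]
[cite: BarriosEtAl2025, Thm. 5.1 (rows R = I₀)] -/
theorem forall_missingInputAt_of_classRecord [Fact (Nat.Prime 3)]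
    (hGZ : ∀ (N : ℕ) [NeZero N] (W : WeierstrassCurve ℚ) (K : Type) [Field K] [NumberField K],
      gross_zagier N W K)
    (hKo : ∀ (N : ℕ) [NeZero N] (W : WeierstrassCurve ℚ) (K : Type) [Field K] [NumberField K],
      kolyvagin N W K)
    (hB : ∀ (N : ℕ) [NeZero N] (W : WeierstrassCurve ℚ) (K : Type) [Field K] [NumberField K],
      Kolyvagin1990_padicValNat_card_sha_le N W K)
    (hSk : Skinner2016.thmC_padicValRat_bsd_rank_zero) (hWu : sha_dvd_analyticSha)
    (hGZK : rank_eq_analyticRank_of_analyticRank_le_one) (hmod : hasEntireLFunction_rat)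
    (hnf : exists_isNewformOf) (hHL : HoffsteinLuo1997_exists_twist_L_one_ne_zero)
    (hMaz : mazur_not_dvd_maninConstant_of_odd)
    (hPT : ∀ (K : Type) [Field K] [NumberField K], poitouTate_sum_localTatePairing_eq_zero K)
    (hEP : ∀ (K : Type) [Field K] [NumberField K] (v : HeightOneSpectrum (𝓞 K)),
      localEulerPoincareCharacteristic (v.adicCompletion K))
    (hFH : friedbergHoffstein_exists_twist_ne_zero_inertAt)
    (hBR : localTamagawaNumber_quadraticTwist_two_mem_of_goodReduction)
    (hSkA : thmA_charIdeal_multiplicative) (hJn : thm61_nonsplitMultiplicative)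
    (hHn : exists_isMultCanonical) (hD : thm1_padicBSD_rankOne_multiplicative)
    (hpar : nonempty_modularParametrizationData)
    -- ROAD (a) NONSPLIT(3) ∧ (ram)
    (hReg : ∀ (W : WeierstrassCurve ℚ) [W.IsElliptic] [W.IsGloballyMinimal],
      ClassX11b W 3 → Ram W 3 → ¬ W.HasSplitMultiplicativeReductionAtPrime 3 →
        ClassClosure.RegulatorNonvanishingAt W 3)
    -- ROAD (b) SPLIT(3) ∧ (ram)
    (hL : ∀ (W : WeierstrassCurve ℚ) [W.IsElliptic] [W.IsGloballyMinimal],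
      ClassX11b W 3 → Ram W 3 → W.HasSplitMultiplicativeReductionAtPrime 3 → StepLAt W)
    (hSh : ∀ (W : WeierstrassCurve ℚ) [W.IsElliptic] [W.IsGloballyMinimal],
      ClassX11b W 3 → Ram W 3 → W.HasSplitMultiplicativeReductionAtPrime 3 → ¬ ShapeAlpha W →
        ¬ ShapeGamma W → 3 ∣ W.tamagawaProduct → P2ShimuraDisplaysAt W 3)
    (hUα : ∀ (W : WeierstrassCurve ℚ) [W.IsElliptic] [W.IsGloballyMinimal],
      ClassX11b W 3 → Ram W 3 → ShapeAlpha W → Typed.MissingUpperBoundAt W 3)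
    (hUγ : ∀ (W : WeierstrassCurve ℚ) [W.IsElliptic] [W.IsGloballyMinimal],
      ClassX11b W 3 → Ram W 3 → W.HasSplitMultiplicativeReductionAtPrime 3 → ¬ ShapeAlpha W →
        ShapeGamma W → Typed.MissingUpperBoundAt W 3)
    -- ROAD (d) `¬Ram ∧ Surj`
    (hL₀ : ∀ (W : WeierstrassCurve ℚ) [W.IsElliptic] [W.IsGloballyMinimal],
      ClassX11b W 3 → ¬ Ram W 3 → Surj W 3 → StepLAt W)
    (hU₀ : ∀ (W : WeierstrassCurve ℚ) [W.IsElliptic] [W.IsGloballyMinimal],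
      ClassX11b W 3 → Surj W 3 → ¬ Ram W 3 → Typed.MissingUpperBoundAt W 3)
    -- the (T4″)@3 corner, split / nonsplit
    (hCs : ∀ (W : WeierstrassCurve ℚ) [W.IsElliptic] [W.IsGloballyMinimal],
      ClassX11b W 3 → ¬ Surj W 3 → 3 ∣ padicValInt 3 W.minimalDiscriminantInt → ¬ Ram W 3 →
        W.HasSplitMultiplicativeReductionAtPrime 3 → Typed.MissingPPartAt W 3)
    (hCn : ∀ (W : WeierstrassCurve ℚ) [W.IsElliptic] [W.IsGloballyMinimal],
      ClassX11b W 3 → ¬ Surj W 3 → 3 ∣ padicValInt 3 W.minimalDiscriminantInt → ¬ Ram W 3 →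
        ¬ W.HasSplitMultiplicativeReductionAtPrime 3 → Typed.MissingPPartAt W 3)
    (W : WeierstrassCurve ℚ) [W.IsElliptic] [W.IsGloballyMinimal] (hX : ClassX11b W 3) :
    X11Three.MissingInputAt W :=
  X11Three.missingInputAt_of_bsdp hmod hGZK W (le_of_eq hX.1)
    (forall_bsdp_of_classRecord hGZ hKo hB hSk hWu hGZK hmod hnf hHL hMaz hPT hEP hFH hBR hSkA hJn hHn
      hD hpar hReg hL hSh hUα hUγ hL₀ hU₀ hCs hCn W hX)

/-! ### §2. CLASS RECORD v4.1 — the corner binders replaced by the corner's typed inputs -/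

/-- **X11b at `p = 3`, WHOLE CLASS — CLASS RECORD v4.1 IN KERNEL FORM (x11b3-lead gen 4, deal #5
(R5-1)/(R5-4)).** `Three.forall_bsdp_of_classRecord` (v4, p252266) with its two corner binders
`hCs` / `hCn` REPLACED by the corner's typed inputs of `Three.missingPPartAt_of_corner_of_inputs`
(`CornerDischarge.lean`, p253236) and ONE more published fact, Matar–Nekovář 2019 Thm. 0.3 (`hMN`,
Kolyvagin's `K`-bound under irreducibility only). Binder list, by named sub-population (TRUE-OPEN
counts of the 1 684 are EVIDENCE: rmap-3 g6 / x11b3-p2 / p3 / p6):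
* PUBLISHED (20): the twelve of route p2, Friedberg–Hoffstein, Barrios et al. 2025 Thm. 5.1,
  Skinner 2016 Thm. A, Stein–Wuthrich 2013 Thm. 6.1 (non-split) + §4.2, Disegni 2020 Thm. 1,
  modular parametrisation, Matar–Nekovář 2019 Thm. 0.3;
* road (a) NONSPLIT(3) ∧ (ram) [722]: `hReg` — `ClassClosure.RegulatorNonvanishingAt W 3` per pair;
* road (b) SPLIT(3) ∧ (ram) [961]: `hL` — `StepLAt W` [no source]; `hSh` — `P2ShimuraDisplaysAt W 3`
  on pure-(T2β)@3 [31]; `hUα` — upper half on (T2α)@3 [444]; `hUγ` — on (T2γ)@3∖α [16];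
* road (d) `¬Ram ∧ Surj` [1]: `hL₀` — `StepLAt W`; `hU₀` — upper half;
* the (T4″)@3 corner `¬Surj` [0 TRUE-OPEN; 296 class-pairs = split 129 / nonsplit 167]: `hCL` —
  STEP L at the pair's odd Manin-good Heegner data, image-free [no source; `StepLAt`'s body with
  `¬ Surj W 3 →`]; `hCT` — `BSD(E^{d_K},3)` for the rank-`0` odd Heegner twists [no source; the
  twist pair is X11a@3 ∧ `¬Surj`: Skinner 2016 Thm. C needs (ram), Wuthrich 2014 Prop. 21 needs a
  surjective-or-Borel image]; `hCU` — the Euler-system half on corner ∧ `3 ∣ ∏c` [(C2) 208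
  class-pairs; Tamagawa-sharp `K`-bound, x11b3-p8 S12] — the three typed `@[conjecture]` inputs
  `CornerStepLAt` / `CornerTwistAt` / `CornerUpperAt` of x11b3-p8's `X11b/Three/CornerResidual.lean`
  (p253638), consumed through `Three.missingPPartAt_of_corner_of_inputs` (`CornerDischarge.lean`,
  p253236; the by-name inputs unfold to its inline ones) and the bridge
  `missingUpperBoundAt_of_cornerUpperAt`.
CONDITIONAL; nothing booked; labels UNCHANGED (X11 ∧ `r = 1` ∧ `p = 3` CONSTRUCTION-SHAPED, R6.2;
O2 OPEN). [cite: MatarNekovar2019, Thm. 0.3 (p. 456), §0.4, §0.11 (p. 457)]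
[cite: Skinner2016PacificMC, Thm. A and Thm. C (§1)] [cite: SteinWuthrich2013, Thm. 6.1, §4.2]
[cite: Disegni2020, Thm. 1 (§1.2)] [cite: JetchevSkinnerWan2017, §7.4.1–7.4.2 (pp. 30–31), Thm. 4.4.1 (p. 19)]
[cite: Castella2018, Thm. 2.3 (p. 5), Thm. 3.2 (p. 9)] [cite: BarriosEtAl2025, Thm. 5.1 (rows R = I₀)]
[cite: Wuthrich2014, Prop. 21 (p. 400)] [cite: Miller2011LMS, Def. 1.1] -/
theorem forall_bsdp_of_classRecord_v41 [Fact (Nat.Prime 3)]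
    -- PUBLISHED: the twelve named facts of route p2
    (hGZ : ∀ (N : ℕ) [NeZero N] (W : WeierstrassCurve ℚ) (K : Type) [Field K] [NumberField K],
      gross_zagier N W K)
    (hKo : ∀ (N : ℕ) [NeZero N] (W : WeierstrassCurve ℚ) (K : Type) [Field K] [NumberField K],
      kolyvagin N W K)
    (hB : ∀ (N : ℕ) [NeZero N] (W : WeierstrassCurve ℚ) (K : Type) [Field K] [NumberField K],
      Kolyvagin1990_padicValNat_card_sha_le N W K)
    (hSk : Skinner2016.thmC_padicValRat_bsd_rank_zero) (hWu : sha_dvd_analyticSha)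
    (hGZK : rank_eq_analyticRank_of_analyticRank_le_one) (hmod : hasEntireLFunction_rat)
    (hnf : exists_isNewformOf) (hHL : HoffsteinLuo1997_exists_twist_L_one_ne_zero)
    (hMaz : mazur_not_dvd_maninConstant_of_odd)
    (hPT : ∀ (K : Type) [Field K] [NumberField K], poitouTate_sum_localTatePairing_eq_zero K)
    (hEP : ∀ (K : Type) [Field K] [NumberField K] (v : HeightOneSpectrum (𝓞 K)),
      localEulerPoincareCharacteristic (v.adicCompletion K))
    -- PUBLISHED: Friedberg–Hoffstein, Barrios et al. 2025 (binder at `2`), road (a)'s five,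
    -- Matar–Nekovář 2019 Thm. 0.3 (the corner's `K`-bound)
    (hFH : friedbergHoffstein_exists_twist_ne_zero_inertAt)
    (hBR : localTamagawaNumber_quadraticTwist_two_mem_of_goodReduction)
    (hSkA : thmA_charIdeal_multiplicative) (hJn : thm61_nonsplitMultiplicative)
    (hHn : exists_isMultCanonical) (hD : thm1_padicBSD_rankOne_multiplicative)
    (hpar : nonempty_modularParametrizationData)
    (hMN : ∀ (N : ℕ) [NeZero N] (W : WeierstrassCurve ℚ) (K : Type) [Field K] [NumberField K],
      MatarNekovar2019.thm03_padicValNat_card_sha_le_of_irreducible N W K)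
    -- ROAD (a) NONSPLIT(3) ∧ (ram): ONE per-pair input
    (hReg : ∀ (W : WeierstrassCurve ℚ) [W.IsElliptic] [W.IsGloballyMinimal],
      ClassX11b W 3 → Ram W 3 → ¬ W.HasSplitMultiplicativeReductionAtPrime 3 →
        ClassClosure.RegulatorNonvanishingAt W 3)
    -- ROAD (b) SPLIT(3) ∧ (ram): THE open input (S0 currency), displays on pure-β, α / γ∖α binders
    (hL : ∀ (W : WeierstrassCurve ℚ) [W.IsElliptic] [W.IsGloballyMinimal],
      ClassX11b W 3 → Ram W 3 → W.HasSplitMultiplicativeReductionAtPrime 3 → StepLAt W)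
    (hSh : ∀ (W : WeierstrassCurve ℚ) [W.IsElliptic] [W.IsGloballyMinimal],
      ClassX11b W 3 → Ram W 3 → W.HasSplitMultiplicativeReductionAtPrime 3 → ¬ ShapeAlpha W →
        ¬ ShapeGamma W → 3 ∣ W.tamagawaProduct → P2ShimuraDisplaysAt W 3)
    (hUα : ∀ (W : WeierstrassCurve ℚ) [W.IsElliptic] [W.IsGloballyMinimal],
      ClassX11b W 3 → Ram W 3 → ShapeAlpha W → Typed.MissingUpperBoundAt W 3)
    (hUγ : ∀ (W : WeierstrassCurve ℚ) [W.IsElliptic] [W.IsGloballyMinimal],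
      ClassX11b W 3 → Ram W 3 → W.HasSplitMultiplicativeReductionAtPrime 3 → ¬ ShapeAlpha W →
        ShapeGamma W → Typed.MissingUpperBoundAt W 3)
    -- ROAD (d) `¬Ram ∧ Surj`
    (hL₀ : ∀ (W : WeierstrassCurve ℚ) [W.IsElliptic] [W.IsGloballyMinimal],
      ClassX11b W 3 → ¬ Ram W 3 → Surj W 3 → StepLAt W)
    (hU₀ : ∀ (W : WeierstrassCurve ℚ) [W.IsElliptic] [W.IsGloballyMinimal],
      ClassX11b W 3 → Surj W 3 → ¬ Ram W 3 → Typed.MissingUpperBoundAt W 3)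
    -- THE (T4″)@3 CORNER `¬Surj` (x11b3-p8's typed inputs, `CornerResidual.lean`, p253638):
    -- (L) image-free STEP L at the pair's odd Manin-good Heegner data — NO source
    (hCL : ∀ (W : WeierstrassCurve ℚ) [W.IsElliptic] [W.IsGloballyMinimal], CornerStepLAt W)
    -- (Tw) `BSD(E^{d_K},3)` for the rank-0 odd Heegner twists (the X11a@3 ∧ ¬Surj corner) — NO source
    (hCT : ∀ (W : WeierstrassCurve ℚ) [W.IsElliptic] [W.IsGloballyMinimal], CornerTwistAt W)
    -- (U♯) the Tamagawa-sharp `K`-bound on corner ∧ `3 ∣ ∏c` — NO source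
    (hCU : ∀ (W : WeierstrassCurve ℚ) [W.IsElliptic] [W.IsGloballyMinimal], CornerUpperAt W)
    (W : WeierstrassCurve ℚ) [W.IsElliptic] [W.IsGloballyMinimal] (hX : ClassX11b W 3) :
    BSDp W 3 :=
  -- the `ℚ`-level Euler-system half on corner ∧ `3 ∣ ∏c` from (U♯) + (Tw) (x11b3-p8's bridge)
  have hU : ∀ (W : WeierstrassCurve ℚ) [W.IsElliptic] [W.IsGloballyMinimal],
      ClassX11b W 3 → ¬ Surj W 3 → 3 ∣ W.tamagawaProduct → Typed.MissingUpperBoundAt W 3 :=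
    fun W _ _ hX hns ht ↦
      missingUpperBoundAt_of_cornerUpperAt hGZ hKo hGZK hmod hnf hHL hMaz W hX hns ht (hCU W) (hCT W)
  forall_bsdp_of_classRecord hGZ hKo hB hSk hWu hGZK hmod hnf hHL hMaz hPT hEP hFH hBR hSkA hJn hHn hD
    hpar hReg hL hSh hUα hUγ hL₀ hU₀
    (missingPPartAt_of_corner_split_of_inputs hGZ hKo hGZK hmod hnf hHL hMaz hPT hEP hMN
      (fun W _ _ ↦ hCL W) (fun W _ _ ↦ hCT W) hU)
    (missingPPartAt_of_corner_nonsplit_of_inputs hGZ hKo hGZK hmod hnf hHL hMaz hPT hEP hMN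
      (fun W _ _ ↦ hCL W) (fun W _ _ ↦ hCT W) hU)
    W hX

end Summit.BirchSwinnertonDyer.Rank1Residual.X11b.Three

end
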